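import Mathlib
import Literature.AlgebraicGeometry.Resolution.CobordantChartCoefficients
import Literature.AlgebraicGeometry.Resolution.FormalCoordinateChange
import Literature.AlgebraicGeometry.Resolution.FormalInverseFunction
import Literature.AlgebraicGeometry.Resolution.CobordantArcLemma

/-!
# `WeightedInvariant.LocalWeightedDrop`, line `vertex-descent-weight-residues`: the tame slice (`κ`-form)

Route `ResolutionOfSingularities/WeightedInvariant`, crux `LocalWeightedDrop`
(stmt-ResolutionOfSingularities-8899), stub `stub_tameSliceKappa` of the lead's skeleton
`work/LocalWeightedDrop.lean`, PROVED here (statement verbatim from the ledger registration).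

**Statement (TAME SLICE, transport form).** Let `F ∈ k[[x₁,…,xₙ]]`, `w` weights, `c` an exceptional
point of the cobordant blow-up (`cᵢ = 0` whenever `wᵢ = 0`), and factor the transform under the chart
`chart w c : xⱼ ↦ s^{wⱼ}(cⱼ + yⱼ)` (`s = X 0`, `yⱼ = X j.succ`) as `F(chart) = sᵃ · g`.  Fix `i` with
`cᵢ ≠ 0` and a `wᵢ`-th root `r` of `1 + yᵢ/cᵢ` with `r(0) = 1` which is a series in `yᵢ` alone.  Then
`g = u · Φ(κ g)` for a unit `u`, a formal coordinate change `Φ` (zero constant terms, invertible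
linear part) and `κ : yᵢ ↦ 0` (the flat slice, still in `n + 1` variables).

**Proof (Luna slice of the `G_m`-action, made explicit).**  Consider the torus reparametrisation
`Φ₀ : s ↦ r⁻¹ s, yᵢ ↦ yᵢ, yⱼ ↦ r^{wⱼ}(cⱼ + yⱼ) - cⱼ (j ≠ i)`.  A direct computation gives
`Φ₀(chart j) = κ(chart j)` for every `j` (for `j = i` one uses `cᵢ · r^{wᵢ} = cᵢ + yᵢ`), hence
`Φ₀(F(chart)) = κ(F(chart))`, i.e. `(r⁻¹ s)ᵃ · Φ₀(g) = sᵃ · κ(g)`, and cancelling `sᵃ` in the domain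
`k[[s,y]]` gives `Φ₀(g) = rᵃ · κ(g)`.  The explicit inverse `ψ₀ : s ↦ r s, yᵢ ↦ yᵢ,
yⱼ ↦ r^{-wⱼ}(cⱼ + yⱼ) - cⱼ` fixes `r` (because `r` involves only `yᵢ`, which `ψ₀` fixes) and satisfies
`ψ₀(Φ₀(x)) = x` for every variable `x`; so `g = ψ₀(Φ₀ g) = rᵃ · ψ₀(κ g)`.  Take `Φ := ψ₀`, `u := rᵃ`;
the linear part of `ψ₀` is a left inverse-able matrix by the first-order chain rule
(`CobordantArc.linMat_mul_of_comp_eq_X`), hence has unit determinant.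

No new definitions: the two reparametrisation families are introduced through the existence lemma
`TameSliceKappa.exists_torusFamily` and handled only through their values on the variables.
-/

set_option linter.dupNamespace false -- mandated namespace of this single-conjunct summit

namespace Summit.ResolutionOfSingularities.ResolutionOfSingularities.Theorems

open Literature.AlgebraicGeometry.Resolution

namespace TameSliceKappa

open MvPowerSeries

variable {k : Type*} [Field k] {n : ℕ}

/-- A substitution fixing the variable `X i₀` fixes every series involving only `X i₀`
(support hypothesis: every exponent in the support vanishes off `i₀`). -/
theorem subst_eq_self_of_support {ψ : Fin (n + 1) → MvPowerSeries (Fin (n + 1)) k}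
    (hψ : HasSubst ψ) (i₀ : Fin (n + 1)) (hfix : ψ i₀ = X i₀)
    (r : MvPowerSeries (Fin (n + 1)) k)
    (hr : ∀ e : Fin (n + 1) →₀ ℕ, coeff e r ≠ 0 → ∀ l, l ≠ i₀ → e l = 0) :
    subst ψ r = r := by
  classical
  -- exponents in the support of `r` are multiples of `single i₀ 1`
  have hsingle : ∀ d : Fin (n + 1) →₀ ℕ, coeff d r ≠ 0 → d = Finsupp.single i₀ (d i₀) := by
    intro d hd
    ext l
    by_cases hl : l = i₀
    · subst hl; rw [Finsupp.single_eq_same]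
    · rw [Finsupp.single_apply, if_neg (Ne.symm hl)]
      exact hr d hd l hl
  have hprod : ∀ d : Fin (n + 1) →₀ ℕ, coeff d r ≠ 0 →
      (d.prod fun s m => ψ s ^ m) = X i₀ ^ (d i₀) := by
    intro d hd
    conv_lhs => rw [hsingle d hd]
    rw [Finsupp.prod_single_index (h := fun s m => ψ s ^ m) (pow_zero _), hfix]
  ext e
  rw [coeff_subst hψ, finsum_eq_single _ e]
  · by_cases he : coeff e r = 0
    · rw [he, zero_smul]
    · rw [hprod e he, coeff_X_pow, if_pos (hsingle e he), smul_eq_mul, mul_one]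
  · intro d hde
    by_cases hd : coeff d r = 0
    · rw [hd, zero_smul]
    · rw [hprod d hd, coeff_X_pow, if_neg, smul_zero]
      intro h
      exact hde ((hsingle d hd).trans h.symm)

/-- The torus reparametrisation family `s ↦ ρ' s`, `yᵢ ↦ yᵢ`, `yⱼ ↦ ρ^{wⱼ}(cⱼ + yⱼ) - cⱼ`
(`j ≠ i`) exists (it is `Fin.cons` of the displayed components); only its values are used below. -/
theorem exists_torusFamily (w : Fin n → ℕ) (c : Fin n → k) (i : Fin n)
    (ρ ρ' : MvPowerSeries (Fin (n + 1)) k) :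
    ∃ T : Fin (n + 1) → MvPowerSeries (Fin (n + 1)) k, T 0 = ρ' * X 0 ∧ T i.succ = X i.succ ∧
      ∀ j, j ≠ i → T j.succ = ρ ^ (w j) * (C (c j) + X j.succ) - C (c j) :=
  ⟨Fin.cons (ρ' * X 0) fun j => if j = i then X i.succ else ρ ^ (w j) * (C (c j) + X j.succ) - C (c j),
    Fin.cons_zero _ _, by simp, fun j hj => by simp [hj]⟩

/-- The components of a torus reparametrisation family have zero constant terms as soon as
`ρ(0) = 1`. -/
theorem constantCoeff_torusFamily {w : Fin n → ℕ} {c : Fin n → k} {i : Fin n}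
    {ρ ρ' : MvPowerSeries (Fin (n + 1)) k} {T : Fin (n + 1) → MvPowerSeries (Fin (n + 1)) k}
    (hT0 : T 0 = ρ' * X 0) (hTi : T i.succ = X i.succ)
    (hTj : ∀ j, j ≠ i → T j.succ = ρ ^ (w j) * (C (c j) + X j.succ) - C (c j))
    (hρ : constantCoeff ρ = 1) (l : Fin (n + 1)) : constantCoeff (T l) = 0 := by
  refine Fin.cases ?_ (fun j => ?_) l
  · rw [hT0, map_mul, constantCoeff_X, mul_zero]
  · by_cases hj : j = i
    · rw [hj, hTi, constantCoeff_X]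
    · rw [hTj j hj]
      simp [hρ, constantCoeff_X]

/-- COMPOSITION: the torus reparametrisation with parameters `(ρ₂, ρ₂')` inverts the one with
parameters `(ρ₁, ρ₁')` as soon as `ρ₁ ρ₂ = 1 = ρ₁' ρ₂'` and the outer substitution fixes `ρ₁, ρ₁'`. -/
theorem subst_torusFamily_torusFamily {w : Fin n → ℕ} {c : Fin n → k} {i : Fin n}
    {ρ₁ ρ₁' ρ₂ ρ₂' : MvPowerSeries (Fin (n + 1)) k}
    {T₁ T₂ : Fin (n + 1) → MvPowerSeries (Fin (n + 1)) k}
    (h₁0 : T₁ 0 = ρ₁' * X 0) (h₁i : T₁ i.succ = X i.succ)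
    (h₁j : ∀ j, j ≠ i → T₁ j.succ = ρ₁ ^ (w j) * (C (c j) + X j.succ) - C (c j))
    (h₂0 : T₂ 0 = ρ₂' * X 0) (h₂i : T₂ i.succ = X i.succ)
    (h₂j : ∀ j, j ≠ i → T₂ j.succ = ρ₂ ^ (w j) * (C (c j) + X j.succ) - C (c j))
    (hT₂ : HasSubst T₂) (hfix : subst T₂ ρ₁ = ρ₁) (hfix' : subst T₂ ρ₁' = ρ₁')
    (h12 : ρ₁ * ρ₂ = 1) (h12' : ρ₁' * ρ₂' = 1) (s : Fin (n + 1)) :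
    subst T₂ (T₁ s) = X s := by
  refine Fin.cases ?_ (fun j => ?_) s
  · rw [h₁0, subst_mul hT₂, hfix', subst_X hT₂, h₂0, ← mul_assoc, h12', one_mul]
  · by_cases hj : j = i
    · subst hj
      rw [h₁i, subst_X hT₂, h₂i]
    · rw [h₁j j hj, subst_sub hT₂, subst_mul hT₂, subst_pow hT₂, hfix, subst_add hT₂, subst_C,
        subst_X hT₂, h₂j j hj]
      calc ρ₁ ^ w j * (C (c j) + (ρ₂ ^ w j * (C (c j) + X j.succ) - C (c j))) - C (c j)
          = (ρ₁ * ρ₂) ^ w j * (C (c j) + X j.succ) - C (c j) := by ring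
        _ = X j.succ := by rw [h12, one_pow, one_mul, add_sub_cancel_left]

/-- KEY IDENTITY: the torus reparametrisation `Φ₀ = (r⁻¹ s, …)` built from a `wᵢ`-th root `r` of
`1 + yᵢ/cᵢ` transforms every chart component exactly as the slice substitution `κ : yᵢ ↦ 0` does:
`Φ₀(chart j) = κ(chart j)` (both are `chart j` for `j ≠ i` and `cᵢ s^{wᵢ}` for `j = i`). -/
theorem subst_torusFamily_chart {w : Fin n → ℕ} {c : Fin n → k} {i : Fin n}
    {r : MvPowerSeries (Fin (n + 1)) k} {T κ : Fin (n + 1) → MvPowerSeries (Fin (n + 1)) k}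
    (hT0 : T 0 = r⁻¹ * X 0) (hTi : T i.succ = X i.succ)
    (hTj : ∀ j, j ≠ i → T j.succ = r ^ (w j) * (C (c j) + X j.succ) - C (c j))
    (hκ0 : κ 0 = X 0) (hκi : κ i.succ = 0) (hκj : ∀ j, j ≠ i → κ j.succ = X j.succ)
    (hκ : HasSubst κ) (hr1 : constantCoeff r = 1) (hci : c i ≠ 0)
    (hrw : r ^ (w i) = 1 + C (c i)⁻¹ * X i.succ) (j : Fin n) :
    subst T (CobordantChart.chart w c j) = subst κ (CobordantChart.chart w c j) := by
  have hr0 : constantCoeff r ≠ 0 := by rw [hr1]; exact one_ne_zero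
  have hT : HasSubst T := hasSubst_of_constantCoeff_zero (constantCoeff_torusFamily hT0 hTi hTj hr1)
  rw [CobordantChart.chart_apply, subst_mul hT, subst_pow hT, subst_X hT, subst_add hT, subst_C,
    subst_X hT, hT0, subst_mul hκ, subst_pow hκ, subst_X hκ, subst_add hκ, subst_C, subst_X hκ, hκ0]
  by_cases hj : j = i
  · subst hj
    rw [hTi, hκi, add_zero]
    have key : C (c j) + X j.succ = C (c j) * r ^ (w j) := by
      rw [hrw, mul_add, mul_one, ← mul_assoc, ← map_mul, mul_inv_cancel₀ hci, map_one, one_mul]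
    rw [key]
    calc (r⁻¹ * X 0) ^ w j * (C (c j) * r ^ w j)
        = (r⁻¹ * r) ^ (w j) * (X 0 ^ w j * C (c j)) := by ring
      _ = X 0 ^ w j * C (c j) := by rw [MvPowerSeries.inv_mul_cancel _ hr0, one_pow, one_mul]
  · rw [hTj j hj, hκj j hj]
    calc (r⁻¹ * X 0) ^ w j * (C (c j) + (r ^ w j * (C (c j) + X j.succ) - C (c j)))
        = (r⁻¹ * r) ^ (w j) * (X 0 ^ w j * (C (c j) + X j.succ)) := by ring
      _ = X 0 ^ w j * (C (c j) + X j.succ) := by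
          rw [MvPowerSeries.inv_mul_cancel _ hr0, one_pow, one_mul]

end TameSliceKappa

open TameSliceKappa in
/-- TAME SLICE in transport form (stub `stub_tameSliceKappa` of the line
`vertex-descent-weight-residues` of crux `LocalWeightedDrop`, stmt-ResolutionOfSingularities-8899).
In the factorisation `F(s^w(c+y)) = sᵃ·g` at an exceptional point `c` (convention `cᵢ = 0` when
`wᵢ = 0`), given `i` with `cᵢ ≠ 0` and a `wᵢ`-th root `r` of `1 + yᵢ/cᵢ` with `r(0) = 1` involving
only `yᵢ`, the `s`-saturated successor `g` is a unit times a formal coordinate change (zero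
constant terms, invertible linear part) of its flat slice `κ(g) = g|_{yᵢ = 0}`. -/
theorem stub_tameSliceKappa : ∀ (k : Type) [Field k] (n : ℕ) (F : MvPowerSeries (Fin n) k) (w : Fin n → ℕ)
    (c : Fin n → k), (∀ i, w i = 0 → c i = 0) → ∀ (a : ℕ) (g : MvPowerSeries (Fin (n + 1)) k),
    MvPowerSeries.subst (CobordantChart.chart w c) F = MvPowerSeries.X 0 ^ a * g →
    ∀ (i : Fin n), c i ≠ 0 → ∀ (r : MvPowerSeries (Fin (n + 1)) k), MvPowerSeries.constantCoeff r = 1 →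
    r ^ (w i) = 1 + MvPowerSeries.C (c i)⁻¹ * MvPowerSeries.X i.succ →
    (∀ e : Fin (n + 1) →₀ ℕ, MvPowerSeries.coeff e r ≠ 0 → ∀ l, l ≠ i.succ → e l = 0) →
    ∃ (Φ : Fin (n + 1) → MvPowerSeries (Fin (n + 1)) k) (u : MvPowerSeries (Fin (n + 1)) k),
      (∀ j, MvPowerSeries.constantCoeff (Φ j) = 0) ∧
      IsUnit (Matrix.det (Matrix.of fun j l => MvPowerSeries.coeff (Finsupp.single l 1) (Φ j))) ∧
      MvPowerSeries.constantCoeff u ≠ 0 ∧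
      g = u * MvPowerSeries.subst Φ (MvPowerSeries.subst
        (fun j : Fin (n + 1) => if j = i.succ then (0 : MvPowerSeries (Fin (n + 1)) k) else MvPowerSeries.X j) g) := by
  intro k _ n F w c hc a g hfac i hci r hr1 hrw hrsupp
  -- the slice substitution `κ : yᵢ ↦ 0`
  set κ : Fin (n + 1) → MvPowerSeries (Fin (n + 1)) k :=
    fun j => if j = i.succ then (0 : MvPowerSeries (Fin (n + 1)) k) else MvPowerSeries.X j with hκdef
  have hκ0 : κ 0 = MvPowerSeries.X 0 := if_neg (Fin.succ_ne_zero i).symm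
  have hκi : κ i.succ = 0 := if_pos rfl
  have hκj : ∀ j, j ≠ i → κ j.succ = MvPowerSeries.X j.succ :=
    fun j hj => if_neg fun h => hj (Fin.succ_injective _ h)
  have hκc : ∀ l, MvPowerSeries.constantCoeff (κ l) = 0 := by
    intro l
    by_cases hl : l = i.succ
    · rw [hl, hκi, map_zero]
    · have : κ l = MvPowerSeries.X l := if_neg hl
      rw [this, MvPowerSeries.constantCoeff_X]
  have hκs : MvPowerSeries.HasSubst κ := MvPowerSeries.hasSubst_of_constantCoeff_zero hκc
  -- the unit `r`
  have hr0 : MvPowerSeries.constantCoeff r ≠ 0 := by rw [hr1]; exact one_ne_zero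
  have hri1 : MvPowerSeries.constantCoeff r⁻¹ = 1 := by
    rw [MvPowerSeries.constantCoeff_inv, hr1, inv_one]
  -- the torus reparametrisation `Φ₀` and its explicit inverse `ψ₀`
  obtain ⟨Φ₀, hΦ0, hΦi, hΦj⟩ := exists_torusFamily w c i r r⁻¹
  obtain ⟨ψ₀, hψ0, hψi, hψj⟩ := exists_torusFamily w c i r⁻¹ r
  have hΦc : ∀ l, MvPowerSeries.constantCoeff (Φ₀ l) = 0 := constantCoeff_torusFamily hΦ0 hΦi hΦj hr1
  have hψc : ∀ l, MvPowerSeries.constantCoeff (ψ₀ l) = 0 :=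
    constantCoeff_torusFamily hψ0 hψi hψj hri1
  have hΦs : MvPowerSeries.HasSubst Φ₀ := MvPowerSeries.hasSubst_of_constantCoeff_zero hΦc
  have hψs : MvPowerSeries.HasSubst ψ₀ := MvPowerSeries.hasSubst_of_constantCoeff_zero hψc
  -- `ψ₀` fixes `r` (a series in `yᵢ` alone) and hence `r⁻¹`
  have hfix : MvPowerSeries.subst ψ₀ r = r := subst_eq_self_of_support hψs i.succ hψi r hrsupp
  have hfix' : MvPowerSeries.subst ψ₀ r⁻¹ = r⁻¹ := by
    rw [MvPowerSeries.eq_inv_iff_mul_eq_one hr0]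
    calc MvPowerSeries.subst ψ₀ r⁻¹ * r
        = MvPowerSeries.subst ψ₀ r⁻¹ * MvPowerSeries.subst ψ₀ r := by rw [hfix]
      _ = MvPowerSeries.subst ψ₀ (r⁻¹ * r) := (MvPowerSeries.subst_mul hψs _ _).symm
      _ = 1 := by
          rw [MvPowerSeries.inv_mul_cancel _ hr0, ← MvPowerSeries.coe_substAlgHom hψs, map_one]
  -- `ψ₀ ∘ Φ₀ = id` on variables
  have hcomp : ∀ s, MvPowerSeries.subst ψ₀ (Φ₀ s) = MvPowerSeries.X s :=
    subst_torusFamily_torusFamily hΦ0 hΦi hΦj hψ0 hψi hψj hψs hfix hfix'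
      (MvPowerSeries.mul_inv_cancel _ hr0) (MvPowerSeries.inv_mul_cancel _ hr0)
  -- `Φ₀(F(chart)) = κ(F(chart))`
  have e1 : MvPowerSeries.subst Φ₀ (MvPowerSeries.subst (CobordantChart.chart w c) F) =
      MvPowerSeries.subst κ (MvPowerSeries.subst (CobordantChart.chart w c) F) := by
    rw [MvPowerSeries.subst_comp_subst_apply (CobordantChart.hasSubst_chart w c hc) hΦs,
      MvPowerSeries.subst_comp_subst_apply (CobordantChart.hasSubst_chart w c hc) hκs]
    congr 1
    funext j
    exact subst_torusFamily_chart hΦ0 hΦi hΦj hκ0 hκi hκj hκs hr1 hci hrw j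
  rw [hfac, MvPowerSeries.subst_mul hΦs, MvPowerSeries.subst_pow hΦs, MvPowerSeries.subst_X hΦs,
    MvPowerSeries.subst_mul hκs, MvPowerSeries.subst_pow hκs, MvPowerSeries.subst_X hκs, hΦ0,
    hκ0] at e1
  -- cancel `sᵃ`: `Φ₀(g) = rᵃ · κ(g)`
  have e2 : MvPowerSeries.X 0 ^ a * MvPowerSeries.subst Φ₀ g =
      MvPowerSeries.X 0 ^ a * (r ^ a * MvPowerSeries.subst κ g) := by
    calc MvPowerSeries.X 0 ^ a * MvPowerSeries.subst Φ₀ g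
        = (r * r⁻¹) ^ a * (MvPowerSeries.X 0 ^ a * MvPowerSeries.subst Φ₀ g) := by
          rw [MvPowerSeries.mul_inv_cancel _ hr0, one_pow, one_mul]
      _ = r ^ a * ((r⁻¹ * MvPowerSeries.X 0) ^ a * MvPowerSeries.subst Φ₀ g) := by ring
      _ = r ^ a * (MvPowerSeries.X 0 ^ a * MvPowerSeries.subst κ g) := by rw [e1]
      _ = MvPowerSeries.X 0 ^ a * (r ^ a * MvPowerSeries.subst κ g) := by ring
  have hX : (MvPowerSeries.X 0 : MvPowerSeries (Fin (n + 1)) k) ^ a ≠ 0 :=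
    pow_ne_zero _ (FormalCoordChange.X_ne_zero' 0)
  have e3 : MvPowerSeries.subst Φ₀ g = r ^ a * MvPowerSeries.subst κ g := mul_left_cancel₀ hX e2
  -- pull back along `ψ₀`
  have e4 : MvPowerSeries.subst ψ₀ (MvPowerSeries.subst Φ₀ g) = g := by
    rw [MvPowerSeries.subst_comp_subst_apply hΦs hψs, funext hcomp, MvPowerSeries.subst_self, id]
  refine ⟨ψ₀, r ^ a, hψc, ?_, ?_, ?_⟩
  · exact Matrix.isUnit_det_of_left_inverse (CobordantArc.linMat_mul_of_comp_eq_X hψc hcomp)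
  · rw [map_pow, hr1, one_pow]
    exact one_ne_zero
  · calc g = MvPowerSeries.subst ψ₀ (MvPowerSeries.subst Φ₀ g) := e4.symm
      _ = MvPowerSeries.subst ψ₀ (r ^ a * MvPowerSeries.subst κ g) := by rw [e3]
      _ = r ^ a * MvPowerSeries.subst ψ₀ (MvPowerSeries.subst κ g) := by
          rw [MvPowerSeries.subst_mul hψs, MvPowerSeries.subst_pow hψs, hfix]

end Summit.ResolutionOfSingularities.ResolutionOfSingularities.Theorems
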